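import Summits.CriticalPhenomena.CardyFormulaZ2.Theorems.CardySusyWardWeakHolomorphyInTemplate
import Summits.CriticalPhenomena.CardyFormulaZ2.Theorems.CardySusyWardWeakHolomorphyLawEquivalence
import Summits.CriticalPhenomena.CardyFormulaZ2.Theorems.CardySusyWardWeakHolomorphyWeakKirchhoff

/-!
# Staggered arrival law ⟺ staggered once-LEFT law, per family and test function, given the free four-dart mode

Line `Sketch` of the crux `CardySusyWard.WeakHolomorphy` (stmt-CriticalPhenomena-11292), skeleton v12 (lead c5), stub
`stub_staggeredArrivalOfOnceLeft` (bookkeeping + explicit non-vanishing constants).  At one mesh `δ` of a family `Λ`: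
`F_k = bondDartObservable (Λ δ) δ (1/3) (medialCornersAt p.1 p.2 k)`, `z_p = medialPoint δ (medialVertexOf p)`, `s_p = ±1`
(horizontal / vertical), `Z_t = onceChiralObs (Λ δ) δ (1/3) (medialVertexOf p) t` (`t = true`: LEFT, `false`: RIGHT),
`λ = e^{−iπ/6}`, `λ̄ = e^{iπ/6}`, `∂φ = (∂_xφ − i∂_yφ)/2`; the `∂φ`-tested staggered pairings (finsums over `p`)
`W_in = Σ ∂φ(z_p)·s_p·in_p` (`s_p·in_p = F₁+F₃` resp. `−(F₀+F₂)`), `W_4 = Σ ∂φ(z_p)·s_p·ΣₖF_k`, `W_t = Σ ∂φ(z_p)·s_p·Z_t`.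

* `staggeredIn_eq_sign_mul_onceTemplate`, `fourDart_eq_onceTemplate`: at an interior vertex of hole-free admissible data
  `s·in = s·((2+λ²) Z_L + (2+λ̄²) Z_R)` and `F₀+F₁+F₂+F₃ = A_L Z_L + A_R Z_R`, `A_L = 2+λ²+2λ+λ̄`, `A_R = 2+λ̄²+2λ̄+λ`
  (`inTemplateIdentity`, `outTemplateIdentity`);
* `staggeredPairings_eventually_eq`: along an admissible family, for a weight vanishing off a compact `K ⊂ Ω`, EVENTUALLY
  `W_in = (2+λ²) W_L + (2+λ̄²) W_R` and `W_4 = A_L W_L + A_R W_R` (bulk dichotomy `stub_bulkDichotomy`; in the non-interior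
  branch every `F_k`, `Z_t` above `K` vanishes; finsums are finite sums over the vertex set of `stub_count`);
* `arrivalCoeffR_ne_zero` (`Re A_R = 5/2 + 3√3/2`), `onceTemplateDet_ne_zero` (`(2+λ²) A_R − (2+λ̄²) A_L = −2i`);
* given the free mode (`δ^{5/3} W_4 → 0` at the weight `∂φ`): `staggeredOnceRight_of_staggeredOnceLeft`
  (`δ^{5/3} W_L → 0 ⟹ δ^{5/3} W_R → 0`), `stub_staggeredArrivalOfOnceLeft` (REGISTERED: `⟹ δ^{5/3} W_in → 0`), the converse
  `staggeredOnceLeft_of_staggeredArrival` (Cramer) and the per-family iff `staggeredOnceLeft_tendsto_iff_staggeredArrival`.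

References: Duminil-Copin–Smirnov arXiv:1109.1549 §8.3 (Conj. 8.7); Zhou arXiv:2409.03235 §4 eq. (102). -/

noncomputable section

namespace Summit.CriticalPhenomena.CardyFormulaZ2.Theorems.WeakHolomorphy.SplitBypass

open scoped BigOperators Topology
open Filter Set MeasureTheory Complex
open _root_.Literature.Probability.LatticeModels
open _root_.Literature.Probability.RandomPlanarGeometry (DobrushinDomain)
open _root_.Literature.Probability.Percolation (BondConfig bondPercolation half)
open _root_.Literature.Barriers.CriticalPhenomena (medialCornersAt medialVertexOf)
open Summit.CriticalPhenomena.CardyFormulaZ2.Theorems.ParafermionPrecompact.Negative (IsFamily)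
open Summit.CriticalPhenomena.CardyFormulaZ2.Theorems.ParafermionFamiliesToSLESix.StripAnchored (IsInteriorMV)

/-! ## The two constants -/

/-- `A_R = 2 + λ̄² + 2λ̄ + λ ≠ 0` (`λ = e^{-iπ/6}`): its real part is `2 + cos(π/3) + 3 cos(π/6) = 5/2 + 3√3/2 > 0`. [folklore] -/
theorem arrivalCoeffR_ne_zero : (2 + Complex.exp ((Real.pi / 6 : ℝ) * Complex.I) ^ 2 +
    2 * Complex.exp ((Real.pi / 6 : ℝ) * Complex.I) + Complex.exp (-(Real.pi / 6 : ℝ) * Complex.I)) ≠ 0 := by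
  intro h
  have hre := congrArg Complex.re h
  rw [← Complex.ofReal_neg] at hre
  simp only [Complex.add_re, Complex.mul_re, sq, Complex.exp_ofReal_mul_I_re, Complex.exp_ofReal_mul_I_im,
    Complex.re_ofNat, Complex.im_ofNat, Real.cos_neg, Complex.zero_re, zero_mul, sub_zero] at hre
  rw [Real.cos_pi_div_six, Real.sin_pi_div_six] at hre
  nlinarith [Real.sqrt_nonneg 3, Real.sq_sqrt (show (0:ℝ) ≤ 3 by norm_num)]

/-- The determinant of the `2 × 2` system `(W_in, W_4) ↔ (W_L, W_R)`: `(2+λ²)·A_R − (2+λ̄²)·A_L ≠ 0` (it equals `−2i`;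
its imaginary part is `−2`). [folklore] -/
theorem onceTemplateDet_ne_zero :
    (2 + Complex.exp (-(Real.pi / 6 : ℝ) * Complex.I) ^ 2) *
        (2 + Complex.exp ((Real.pi / 6 : ℝ) * Complex.I) ^ 2 + 2 * Complex.exp ((Real.pi / 6 : ℝ) * Complex.I) +
          Complex.exp (-(Real.pi / 6 : ℝ) * Complex.I)) -
      (2 + Complex.exp ((Real.pi / 6 : ℝ) * Complex.I) ^ 2) *
        (2 + Complex.exp (-(Real.pi / 6 : ℝ) * Complex.I) ^ 2 + 2 * Complex.exp (-(Real.pi / 6 : ℝ) * Complex.I) +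
          Complex.exp ((Real.pi / 6 : ℝ) * Complex.I)) ≠ 0 := by
  intro h
  have him := congrArg Complex.im h
  rw [← Complex.ofReal_neg] at him
  simp only [Complex.add_im, Complex.sub_im, Complex.mul_im, Complex.add_re, Complex.mul_re, sq,
    Complex.exp_ofReal_mul_I_re, Complex.exp_ofReal_mul_I_im, Complex.re_ofNat, Complex.im_ofNat, Real.cos_neg,
    Real.sin_neg, Complex.zero_im, zero_mul, sub_zero, add_zero] at him
  rw [Real.cos_pi_div_six, Real.sin_pi_div_six] at him
  nlinarith [Real.sqrt_nonneg 3, Real.sq_sqrt (show (0:ℝ) ≤ 3 by norm_num)]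

/-! ## `∂φ` is a smooth compactly supported weight (local copies) -/

/-- If `∂φ(z) ≠ 0` then `z ∈ tsupport φ` (`fderiv` vanishes off `tsupport`). [folklore] -/
private theorem ol_mem_tsupport_of_del_ne_zero (φ : ℂ → ℂ) {z : ℂ}
    (hz : (fderiv ℝ φ z 1 - Complex.I * fderiv ℝ φ z Complex.I) / 2 ≠ 0) : z ∈ tsupport φ := by
  by_contra h
  exact hz (by rw [fderiv_of_notMem_tsupport ℝ h]; simp)

/-- `∂φ = (∂_xφ − i∂_yφ)/2` of a `C^∞` map `φ : ℂ → ℂ` is `C^∞`. [folklore] -/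
private theorem ol_del_contDiff (φ : ℂ → ℂ) (hφ : ContDiff ℝ (⊤ : ℕ∞) φ) :
    ContDiff ℝ (⊤ : ℕ∞) (fun z => (fderiv ℝ φ z 1 - Complex.I * fderiv ℝ φ z Complex.I) / 2) := by
  have hd : ContDiff ℝ (⊤ : ℕ∞) (fderiv ℝ φ) := (contDiff_infty_iff_fderiv.1 hφ).2
  have h1 : ContDiff ℝ (⊤ : ℕ∞) (fun z => fderiv ℝ φ z 1) := hd.clm_apply contDiff_const
  have hI : ContDiff ℝ (⊤ : ℕ∞) (fun z => fderiv ℝ φ z Complex.I) := hd.clm_apply contDiff_const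
  exact (h1.sub (contDiff_const.mul hI)).div_const 2

/-- `∂φ` of a compactly supported `φ : ℂ → ℂ` is compactly supported. [folklore] -/
private theorem ol_del_hasCompactSupport (φ : ℂ → ℂ) (hc : HasCompactSupport φ) :
    HasCompactSupport (fun z => (fderiv ℝ φ z 1 - Complex.I * fderiv ℝ φ z Complex.I) / 2) := by
  refine hc.mono' fun z hz => ?_
  rw [Function.mem_support] at hz
  exact ol_mem_tsupport_of_del_ne_zero φ hz

/-! ## Termwise identities at an interior medial vertex -/

/-- **The staggered arriving sum through the node template**: at an interior medial vertex of hole-free admissible data,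
`s_p·in_p = s_p·((2+λ²) Z_L + (2+λ̄²) Z_R)`, where `s_p·in_p = F₁ + F₃` at a horizontal and `−(F₀ + F₂)` at a vertical vertex
(`inTemplateIdentity`, whose left-hand side is `F₁ + F₃` resp. `F₀ + F₂`). [cite: Zhou2024SLE6BondZ2, eq. (102)] -/
theorem staggeredIn_eq_sign_mul_onceTemplate {E : DiscreteDobrushin} (hE : E.IsZdAdmissible)
    (hH : HoleFree {f : Site 2 | E.IsInnerFace f}) (p : Site 2 × Fin 2) (hp : IsInteriorMV E p) {δ : ℝ} (hδ : 0 < δ) :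
    (if p.2 = 0 then
        bondDartObservable E δ (1 / 3) (medialCornersAt p.1 p.2 1) + bondDartObservable E δ (1 / 3) (medialCornersAt p.1 p.2 3)
      else
        -(bondDartObservable E δ (1 / 3) (medialCornersAt p.1 p.2 0) +
          bondDartObservable E δ (1 / 3) (medialCornersAt p.1 p.2 2))) =
      (if p.2 = 0 then (1 : ℂ) else -1) *
        ((2 + Complex.exp (-(Real.pi / 6 : ℝ) * Complex.I) ^ 2) * onceChiralObs E δ (1 / 3) (medialVertexOf p) true +
          (2 + Complex.exp ((Real.pi / 6 : ℝ) * Complex.I) ^ 2) * onceChiralObs E δ (1 / 3) (medialVertexOf p) false) := by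
  have hin := inTemplateIdentity hE hH p hp hδ
  obtain ⟨x, i⟩ := p
  obtain rfl | rfl : i = 0 ∨ i = 1 := by fin_cases i <;> simp
  · rw [if_pos rfl, if_pos rfl] at hin
    rw [if_pos rfl, if_pos rfl, hin, one_mul]
  · rw [if_neg (show ¬ ((1 : Fin 2) = 0) by decide), if_neg (show ¬ ((1 : Fin 2) = 0) by decide)] at hin
    rw [if_neg (show ¬ ((1 : Fin 2) = 0) by decide), if_neg (show ¬ ((1 : Fin 2) = 0) by decide), hin]
    ring

/-- **The four-dart sum through the node template**: at an interior medial vertex of hole-free admissible data,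
`F₀ + F₁ + F₂ + F₃ = in + out = A_L Z_L + A_R Z_R` with `A_L = 2 + λ² + 2λ + λ̄`, `A_R = 2 + λ̄² + 2λ̄ + λ`
(`inTemplateIdentity` plus `outTemplateIdentity`). [cite: Zhou2024SLE6BondZ2, eq. (102)] -/
theorem fourDart_eq_onceTemplate {E : DiscreteDobrushin} (hE : E.IsZdAdmissible)
    (hH : HoleFree {f : Site 2 | E.IsInnerFace f}) (p : Site 2 × Fin 2) (hp : IsInteriorMV E p) {δ : ℝ} (hδ : 0 < δ) :
    bondDartObservable E δ (1 / 3) (medialCornersAt p.1 p.2 0) + bondDartObservable E δ (1 / 3) (medialCornersAt p.1 p.2 1) +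
        bondDartObservable E δ (1 / 3) (medialCornersAt p.1 p.2 2) + bondDartObservable E δ (1 / 3) (medialCornersAt p.1 p.2 3) =
      (2 + Complex.exp (-(Real.pi / 6 : ℝ) * Complex.I) ^ 2 + 2 * Complex.exp (-(Real.pi / 6 : ℝ) * Complex.I) +
            Complex.exp ((Real.pi / 6 : ℝ) * Complex.I)) * onceChiralObs E δ (1 / 3) (medialVertexOf p) true +
        (2 + Complex.exp ((Real.pi / 6 : ℝ) * Complex.I) ^ 2 + 2 * Complex.exp ((Real.pi / 6 : ℝ) * Complex.I) +
            Complex.exp (-(Real.pi / 6 : ℝ) * Complex.I)) * onceChiralObs E δ (1 / 3) (medialVertexOf p) false := by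
  have hin := inTemplateIdentity hE hH p hp hδ
  have hout := outTemplateIdentity hE hH p hp hδ
  obtain ⟨x, i⟩ := p
  obtain rfl | rfl : i = 0 ∨ i = 1 := by fin_cases i <;> simp
  · rw [if_pos rfl, if_pos rfl] at hin hout
    linear_combination hin + hout
  · rw [if_neg (show ¬ ((1 : Fin 2) = 0) by decide), if_neg (show ¬ ((1 : Fin 2) = 0) by decide)] at hin hout
    linear_combination hin + hout

/-! ## The eventual identities of the weighted staggered pairings -/

/-- **The staggered pairings through the node template, eventually.** Along an admissible family `Λ` of `D`, for a compact
`K ⊂ Ω` and any weight `w : ℂ → ℂ` vanishing off `K`, eventually in `δ`: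
`Σ_p w(z_p)·s_p·in_p = (2+λ²) Σ_p w(z_p)·s_p·Z_L + (2+λ̄²) Σ_p w(z_p)·s_p·Z_R` and
`Σ_p w(z_p)·s_p·(F₀+F₁+F₂+F₃) = A_L Σ_p w(z_p)·s_p·Z_L + A_R Σ_p w(z_p)·s_p·Z_R` (bulk dichotomy: in the interior branch the
termwise identities above, in the other branch every `F_k` and `Z_t` above `K` vanishes; all `finsum`s are finite sums over the
vertex set of `stub_count`). [folklore] -/
theorem staggeredPairings_eventually_eq (D : DobrushinDomain) (Λ : ℝ → DiscreteDobrushin) (hΛ : IsFamily D Λ)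
    (K : Set ℂ) (hK : IsCompact K) (hKD : K ⊆ D.carrier) (w : ℂ → ℂ) (hw : ∀ z, w z ≠ 0 → z ∈ K) :
    ∀ᶠ δ in 𝓝[>] (0:ℝ),
      (∑ᶠ p : Site 2 × Fin 2, w (medialPoint δ (medialVertexOf p)) *
          (if p.2 = 0 then
              bondDartObservable (Λ δ) δ (1 / 3) (medialCornersAt p.1 p.2 1) +
                bondDartObservable (Λ δ) δ (1 / 3) (medialCornersAt p.1 p.2 3)
            else
              -(bondDartObservable (Λ δ) δ (1 / 3) (medialCornersAt p.1 p.2 0) +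
                bondDartObservable (Λ δ) δ (1 / 3) (medialCornersAt p.1 p.2 2))) =
        (2 + Complex.exp (-(Real.pi / 6 : ℝ) * Complex.I) ^ 2) *
            ∑ᶠ p : Site 2 × Fin 2, w (medialPoint δ (medialVertexOf p)) *
              ((if p.2 = 0 then (1 : ℂ) else -1) * onceChiralObs (Λ δ) δ (1 / 3) (medialVertexOf p) true) +
          (2 + Complex.exp ((Real.pi / 6 : ℝ) * Complex.I) ^ 2) *
            ∑ᶠ p : Site 2 × Fin 2, w (medialPoint δ (medialVertexOf p)) *
              ((if p.2 = 0 then (1 : ℂ) else -1) * onceChiralObs (Λ δ) δ (1 / 3) (medialVertexOf p) false)) ∧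
      (∑ᶠ p : Site 2 × Fin 2, w (medialPoint δ (medialVertexOf p)) * ((if p.2 = 0 then (1 : ℂ) else -1) *
          (bondDartObservable (Λ δ) δ (1 / 3) (medialCornersAt p.1 p.2 0) +
            bondDartObservable (Λ δ) δ (1 / 3) (medialCornersAt p.1 p.2 1) +
            bondDartObservable (Λ δ) δ (1 / 3) (medialCornersAt p.1 p.2 2) +
            bondDartObservable (Λ δ) δ (1 / 3) (medialCornersAt p.1 p.2 3))) =
        (2 + Complex.exp (-(Real.pi / 6 : ℝ) * Complex.I) ^ 2 + 2 * Complex.exp (-(Real.pi / 6 : ℝ) * Complex.I) +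
              Complex.exp ((Real.pi / 6 : ℝ) * Complex.I)) *
            ∑ᶠ p : Site 2 × Fin 2, w (medialPoint δ (medialVertexOf p)) *
              ((if p.2 = 0 then (1 : ℂ) else -1) * onceChiralObs (Λ δ) δ (1 / 3) (medialVertexOf p) true) +
          (2 + Complex.exp ((Real.pi / 6 : ℝ) * Complex.I) ^ 2 + 2 * Complex.exp ((Real.pi / 6 : ℝ) * Complex.I) +
              Complex.exp (-(Real.pi / 6 : ℝ) * Complex.I)) *
            ∑ᶠ p : Site 2 × Fin 2, w (medialPoint δ (medialVertexOf p)) *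
              ((if p.2 = 0 then (1 : ℂ) else -1) * onceChiralObs (Λ δ) δ (1 / 3) (medialVertexOf p) false)) := by
  classical
  obtain ⟨CN, hCN⟩ := stub_count K hK
  have hadm := hΛ.2.2.2.2.2
  have E4 : ∀ᶠ δ in 𝓝[>] (0:ℝ), δ ∈ Set.Ioo (0:ℝ) 1 := Ioo_mem_nhdsGT one_pos
  filter_upwards [stub_bulkDichotomy D Λ hΛ K hK hKD, hadm, E4] with δ hdich hA hδ
  have hδ0 : (0:ℝ) < δ := hδ.1
  obtain ⟨S, hS, -⟩ := hCN δ hδ0 hδ.2.le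
  have hHF : HoleFree {f : Site 2 | (Λ δ).IsInnerFace f} :=
    holeFree_innerFaces D.toJordanDomain (hΛ.1 δ) (by rw [hΛ.2.1 δ]; exact hδ0)
  -- all `finsum`s are finite sums over `S`
  have key : ∀ g : Site 2 × Fin 2 → ℂ, ∑ᶠ p : Site 2 × Fin 2, w (medialPoint δ (medialVertexOf p)) * g p =
      ∑ p ∈ S, w (medialPoint δ (medialVertexOf p)) * g p := fun g => by
    refine finsum_eq_sum_of_support_subset _ fun p hp => ?_
    rw [Function.mem_support] at hp
    exact hS p (Metric.self_subset_cthickening K (hw _ fun h0 => hp (by rw [h0, zero_mul])))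
  rw [key, key, key, key]
  refine ⟨?_, ?_⟩
  · rw [Finset.mul_sum, Finset.mul_sum, ← Finset.sum_add_distrib]
    refine Finset.sum_congr rfl fun p _ => ?_
    by_cases hp : w (medialPoint δ (medialVertexOf p)) = 0
    · simp only [hp, zero_mul, mul_zero, add_zero]
    rcases hdich with hint | hvan
    · rw [staggeredIn_eq_sign_mul_onceTemplate hA hHF p (hint p (hw _ hp)) hδ0]
      ring
    · have hF := bondDartObservable_eq_zero_of_vanish (hvan p (hw _ hp))
      have hZ := onceChiralObs_eq_zero_of_vanish hA hδ0.ne' (hvan p (hw _ hp))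
      simp only [hF, hZ, add_zero, neg_zero, mul_zero, ite_self]
  · rw [Finset.mul_sum, Finset.mul_sum, ← Finset.sum_add_distrib]
    refine Finset.sum_congr rfl fun p _ => ?_
    by_cases hp : w (medialPoint δ (medialVertexOf p)) = 0
    · simp only [hp, zero_mul, mul_zero, add_zero]
    rcases hdich with hint | hvan
    · rw [fourDart_eq_onceTemplate hA hHF p (hint p (hw _ hp)) hδ0]
      ring
    · have hF := bondDartObservable_eq_zero_of_vanish (hvan p (hw _ hp))
      have hZ := onceChiralObs_eq_zero_of_vanish hA hδ0.ne' (hvan p (hw _ hp))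
      simp only [hF, hZ, add_zero, mul_zero]

/-! ## Pure algebra of the `2 × 2` system -/

/-- `W_R` from `W_4 = A_L W_L + A_R W_R` and `W_L`. [folklore] -/
private theorem ol_solveR (AL AR T WL WR : ℂ) (hAR : AR ≠ 0) :
    AR⁻¹ * (T * (AL * WL + AR * WR) - AL * (T * WL)) = T * WR := by
  field_simp; ring

/-- `W_L` from `W_in = a W_L + b W_R` and `W_4 = A_L W_L + A_R W_R` (Cramer). [folklore] -/
private theorem ol_solveDet (a b AL AR T WL WR : ℂ) (hdet : a * AR - b * AL ≠ 0) :
    (a * AR - b * AL)⁻¹ * (AR * (T * (a * WL + b * WR)) - b * (T * (AL * WL + AR * WR))) = T * WL := by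
  field_simp; ring

/-- `W_in` from `W_L` and `W_R`. [folklore] -/
private theorem ol_lin (a b T WL WR : ℂ) : a * (T * WL) + b * (T * WR) = T * (a * WL + b * WR) := by ring

/-! ## Once-RIGHT from once-LEFT, and once-LEFT from arrival, given the free four-dart mode -/

section PerFamily

variable (D : DobrushinDomain) (Λ : ℝ → DiscreteDobrushin) (hΛ : IsFamily D Λ) (φ : ℂ → ℂ) (hφ : ContDiff ℝ (⊤ : ℕ∞) φ)
  (hc : HasCompactSupport φ) (hs : tsupport φ ⊆ D.carrier)
  (hfree : ∀ (ψ : ℂ → ℂ), ContDiff ℝ (⊤ : ℕ∞) ψ → HasCompactSupport ψ →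
    Tendsto (fun δ : ℝ => ((δ ^ ((5:ℝ) / 3) : ℝ) : ℂ) * ∑ᶠ p : Site 2 × Fin 2,
        ψ (medialPoint δ (medialVertexOf p)) * ((if p.2 = 0 then (1 : ℂ) else -1) *
          (bondDartObservable (Λ δ) δ (1 / 3) (medialCornersAt p.1 p.2 0) +
            bondDartObservable (Λ δ) δ (1 / 3) (medialCornersAt p.1 p.2 1) +
            bondDartObservable (Λ δ) δ (1 / 3) (medialCornersAt p.1 p.2 2) +
            bondDartObservable (Λ δ) δ (1 / 3) (medialCornersAt p.1 p.2 3))))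
      (𝓝[>] 0) (𝓝 0))
include hΛ hφ hc hs hfree

/-- **Staggered once-RIGHT law from the staggered once-LEFT law.** Along an admissible family `Λ` of `D` whose staggered
four-dart mode is free (`hfree`: the statement of `stub_staggeredFourDartFree` for `Λ`), for a smooth `φ` compactly supported
in the domain: `δ^{5/3} W_L → 0 ⟹ δ^{5/3} W_R → 0`, since eventually `W_4 = A_L W_L + A_R W_R`
(`staggeredPairings_eventually_eq` at the weight `∂φ`), `δ^{5/3} W_4 → 0` (free mode at `ψ := ∂φ`) and `A_R ≠ 0`. [folklore] -/
theorem staggeredOnceRight_of_staggeredOnceLeft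
    (hL : Tendsto (fun δ : ℝ => ((δ ^ ((5:ℝ) / 3) : ℝ) : ℂ) * ∑ᶠ p : Site 2 × Fin 2,
        (fderiv ℝ φ (medialPoint δ (medialVertexOf p)) 1 -
            Complex.I * fderiv ℝ φ (medialPoint δ (medialVertexOf p)) Complex.I) / 2 *
          ((if p.2 = 0 then (1 : ℂ) else -1) * onceChiralObs (Λ δ) δ (1 / 3) (medialVertexOf p) true))
      (𝓝[>] 0) (𝓝 0)) :
    Tendsto (fun δ : ℝ => ((δ ^ ((5:ℝ) / 3) : ℝ) : ℂ) * ∑ᶠ p : Site 2 × Fin 2,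
        (fderiv ℝ φ (medialPoint δ (medialVertexOf p)) 1 -
            Complex.I * fderiv ℝ φ (medialPoint δ (medialVertexOf p)) Complex.I) / 2 *
          ((if p.2 = 0 then (1 : ℂ) else -1) * onceChiralObs (Λ δ) δ (1 / 3) (medialVertexOf p) false))
      (𝓝[>] 0) (𝓝 0) := by
  have h4 := hfree _ (ol_del_contDiff φ hφ) (ol_del_hasCompactSupport φ hc)
  have h := (h4.sub (hL.const_mul (2 + Complex.exp (-(Real.pi / 6 : ℝ) * Complex.I) ^ 2 +
    2 * Complex.exp (-(Real.pi / 6 : ℝ) * Complex.I) + Complex.exp ((Real.pi / 6 : ℝ) * Complex.I)))).const_mul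
    (2 + Complex.exp ((Real.pi / 6 : ℝ) * Complex.I) ^ 2 + 2 * Complex.exp ((Real.pi / 6 : ℝ) * Complex.I) +
      Complex.exp (-(Real.pi / 6 : ℝ) * Complex.I))⁻¹
  simp only [mul_zero, sub_zero] at h
  refine h.congr' ?_
  filter_upwards [staggeredPairings_eventually_eq D Λ hΛ (tsupport φ) hc.isCompact hs
    (fun z => (fderiv ℝ φ z 1 - Complex.I * fderiv ℝ φ z Complex.I) / 2)
    (fun z hz => ol_mem_tsupport_of_del_ne_zero φ hz)] with δ hδ
  rw [hδ.2]
  exact ol_solveR _ _ _ _ _ arrivalCoeffR_ne_zero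

/-- **The converse bookkeeping: staggered once-LEFT law from the staggered arrival law.** Along an admissible family `Λ` of
`D` whose staggered four-dart mode is free, for a smooth `φ` compactly supported in the domain: `δ^{5/3} W_in → 0 ⟹
δ^{5/3} W_L → 0`, by Cramer's rule on `W_in = (2+λ²) W_L + (2+λ̄²) W_R`, `W_4 = A_L W_L + A_R W_R` (eventually), with
`δ^{5/3} W_4 → 0` and the determinant `(2+λ²) A_R − (2+λ̄²) A_L = −2i ≠ 0` (`onceTemplateDet_ne_zero`). [folklore] -/
theorem staggeredOnceLeft_of_staggeredArrival
    (hin : Tendsto (fun δ : ℝ => ((δ ^ ((5:ℝ) / 3) : ℝ) : ℂ) * ∑ᶠ p : Site 2 × Fin 2,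
        (fderiv ℝ φ (medialPoint δ (medialVertexOf p)) 1 -
            Complex.I * fderiv ℝ φ (medialPoint δ (medialVertexOf p)) Complex.I) / 2 *
          (if p.2 = 0 then
              bondDartObservable (Λ δ) δ (1 / 3) (medialCornersAt p.1 p.2 1) +
                bondDartObservable (Λ δ) δ (1 / 3) (medialCornersAt p.1 p.2 3)
            else
              -(bondDartObservable (Λ δ) δ (1 / 3) (medialCornersAt p.1 p.2 0) +
                bondDartObservable (Λ δ) δ (1 / 3) (medialCornersAt p.1 p.2 2))))
      (𝓝[>] 0) (𝓝 0)) :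
    Tendsto (fun δ : ℝ => ((δ ^ ((5:ℝ) / 3) : ℝ) : ℂ) * ∑ᶠ p : Site 2 × Fin 2,
        (fderiv ℝ φ (medialPoint δ (medialVertexOf p)) 1 -
            Complex.I * fderiv ℝ φ (medialPoint δ (medialVertexOf p)) Complex.I) / 2 *
          ((if p.2 = 0 then (1 : ℂ) else -1) * onceChiralObs (Λ δ) δ (1 / 3) (medialVertexOf p) true))
      (𝓝[>] 0) (𝓝 0) := by
  have h4 := hfree _ (ol_del_contDiff φ hφ) (ol_del_hasCompactSupport φ hc)
  have h := ((hin.const_mul (2 + Complex.exp ((Real.pi / 6 : ℝ) * Complex.I) ^ 2 +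
      2 * Complex.exp ((Real.pi / 6 : ℝ) * Complex.I) + Complex.exp (-(Real.pi / 6 : ℝ) * Complex.I))).sub
    (h4.const_mul (2 + Complex.exp ((Real.pi / 6 : ℝ) * Complex.I) ^ 2))).const_mul
    ((2 + Complex.exp (-(Real.pi / 6 : ℝ) * Complex.I) ^ 2) *
        (2 + Complex.exp ((Real.pi / 6 : ℝ) * Complex.I) ^ 2 + 2 * Complex.exp ((Real.pi / 6 : ℝ) * Complex.I) +
          Complex.exp (-(Real.pi / 6 : ℝ) * Complex.I)) -
      (2 + Complex.exp ((Real.pi / 6 : ℝ) * Complex.I) ^ 2) *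
        (2 + Complex.exp (-(Real.pi / 6 : ℝ) * Complex.I) ^ 2 + 2 * Complex.exp (-(Real.pi / 6 : ℝ) * Complex.I) +
          Complex.exp ((Real.pi / 6 : ℝ) * Complex.I)))⁻¹
  simp only [mul_zero, sub_zero] at h
  refine h.congr' ?_
  filter_upwards [staggeredPairings_eventually_eq D Λ hΛ (tsupport φ) hc.isCompact hs
    (fun z => (fderiv ℝ φ z 1 - Complex.I * fderiv ℝ φ z Complex.I) / 2)
    (fun z hz => ol_mem_tsupport_of_del_ne_zero φ hz)] with δ hδ
  rw [hδ.1, hδ.2]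
  exact ol_solveDet _ _ _ _ _ _ _ onceTemplateDet_ne_zero

end PerFamily

/-! ## The registered stub and the per-family equivalence -/

/-- **`stub_staggeredArrivalOfOnceLeft` — bookkeeping, per family and test function.** Along an admissible family `Λ` of `D`
and for a smooth test function `φ` compactly supported in the domain: if the staggered four-dart mode of `Λ` is free (statement of
`stub_staggeredFourDartFree` for this `Λ`) and the staggered once-LEFT law holds for `(D, Λ, φ)` (statement of
`stub_staggeredOnceLeftVanishes`), then the staggered arrival law holds for `(D, Λ, φ)`.  Eventually in `δ` (bulk dichotomy
`stub_bulkDichotomy`: interior branch `inTemplateIdentity` / `outTemplateIdentity`, other branch everything vanishes by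
`bondDartObservable_eq_zero_of_vanish` / `onceChiralObs_eq_zero_of_vanish`) the `∂φ`-tested staggered pairings satisfy
`W_in = (2+λ²) W_L + (2+λ̄²) W_R` and `W_4 = A_L W_L + A_R W_R` (`staggeredPairings_eventually_eq`); by the free mode
`δ^{5/3} W_4 → 0`, and `A_R = 2 + λ̄² + 2λ̄ + λ ≠ 0` (`Re A_R = 5/2 + 3√3/2`), hence `δ^{5/3} W_L → 0 ⟹ δ^{5/3} W_R → 0 ⟹
δ^{5/3} W_in → 0` (`staggeredOnceRight_of_staggeredOnceLeft`). [folklore] -/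
theorem stub_staggeredArrivalOfOnceLeft : ∀ (D : DobrushinDomain) (Λ : ℝ → DiscreteDobrushin), IsFamily D Λ →
    ∀ (φ : ℂ → ℂ), ContDiff ℝ (⊤ : ℕ∞) φ → HasCompactSupport φ → tsupport φ ⊆ D.carrier →
    (∀ (ψ : ℂ → ℂ), ContDiff ℝ (⊤ : ℕ∞) ψ → HasCompactSupport ψ →
      Tendsto (fun δ : ℝ => ((δ ^ ((5:ℝ) / 3) : ℝ) : ℂ) * ∑ᶠ p : Site 2 × Fin 2,
          ψ (medialPoint δ (medialVertexOf p)) * ((if p.2 = 0 then (1 : ℂ) else -1) *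
            (bondDartObservable (Λ δ) δ (1 / 3) (medialCornersAt p.1 p.2 0) +
              bondDartObservable (Λ δ) δ (1 / 3) (medialCornersAt p.1 p.2 1) +
              bondDartObservable (Λ δ) δ (1 / 3) (medialCornersAt p.1 p.2 2) +
              bondDartObservable (Λ δ) δ (1 / 3) (medialCornersAt p.1 p.2 3))))
        (𝓝[>] 0) (𝓝 0)) →
    Tendsto (fun δ : ℝ => ((δ ^ ((5:ℝ) / 3) : ℝ) : ℂ) * ∑ᶠ p : Site 2 × Fin 2,
        (fderiv ℝ φ (medialPoint δ (medialVertexOf p)) 1 -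
            Complex.I * fderiv ℝ φ (medialPoint δ (medialVertexOf p)) Complex.I) / 2 *
          ((if p.2 = 0 then (1 : ℂ) else -1) * onceChiralObs (Λ δ) δ (1 / 3) (medialVertexOf p) true))
      (𝓝[>] 0) (𝓝 0) →
    Tendsto (fun δ : ℝ => ((δ ^ ((5:ℝ) / 3) : ℝ) : ℂ) * ∑ᶠ p : Site 2 × Fin 2,
        (fderiv ℝ φ (medialPoint δ (medialVertexOf p)) 1 -
            Complex.I * fderiv ℝ φ (medialPoint δ (medialVertexOf p)) Complex.I) / 2 *
          (if p.2 = 0 then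
              bondDartObservable (Λ δ) δ (1 / 3) (medialCornersAt p.1 p.2 1) +
                bondDartObservable (Λ δ) δ (1 / 3) (medialCornersAt p.1 p.2 3)
            else
              -(bondDartObservable (Λ δ) δ (1 / 3) (medialCornersAt p.1 p.2 0) +
                bondDartObservable (Λ δ) δ (1 / 3) (medialCornersAt p.1 p.2 2))))
      (𝓝[>] 0) (𝓝 0) := by
  intro D Λ hΛ φ hφ hc hs hfree hL
  have hR := staggeredOnceRight_of_staggeredOnceLeft D Λ hΛ φ hφ hc hs hfree hL
  have h := (hL.const_mul (2 + Complex.exp (-(Real.pi / 6 : ℝ) * Complex.I) ^ 2)).add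
    (hR.const_mul (2 + Complex.exp ((Real.pi / 6 : ℝ) * Complex.I) ^ 2))
  simp only [mul_zero, add_zero] at h
  refine h.congr' ?_
  filter_upwards [staggeredPairings_eventually_eq D Λ hΛ (tsupport φ) hc.isCompact hs
    (fun z => (fderiv ℝ φ z 1 - Complex.I * fderiv ℝ φ z Complex.I) / 2)
    (fun z hz => ol_mem_tsupport_of_del_ne_zero φ hz)] with δ hδ
  rw [hδ.1]
  exact ol_lin _ _ _ _ _

/-- **Staggered once-LEFT law ⟺ staggered arrival law, per family and test function, given the free four-dart mode**
(`stub_staggeredArrivalOfOnceLeft` and `staggeredOnceLeft_of_staggeredArrival`).  With `stub_staggeredFourDartFree` and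
`weakHolomorphy_iff_weakKirchhoff` / `staggeredArrival_tendsto_iff_weakKirchhoff` this makes the once-LEFT law
`stub_staggeredOnceLeftVanishes` crux-equivalent. [folklore] -/
theorem staggeredOnceLeft_tendsto_iff_staggeredArrival (D : DobrushinDomain) (Λ : ℝ → DiscreteDobrushin)
    (hΛ : IsFamily D Λ) (φ : ℂ → ℂ) (hφ : ContDiff ℝ (⊤ : ℕ∞) φ) (hc : HasCompactSupport φ) (hs : tsupport φ ⊆ D.carrier)
    (hfree : ∀ (ψ : ℂ → ℂ), ContDiff ℝ (⊤ : ℕ∞) ψ → HasCompactSupport ψ →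
      Tendsto (fun δ : ℝ => ((δ ^ ((5:ℝ) / 3) : ℝ) : ℂ) * ∑ᶠ p : Site 2 × Fin 2,
          ψ (medialPoint δ (medialVertexOf p)) * ((if p.2 = 0 then (1 : ℂ) else -1) *
            (bondDartObservable (Λ δ) δ (1 / 3) (medialCornersAt p.1 p.2 0) +
              bondDartObservable (Λ δ) δ (1 / 3) (medialCornersAt p.1 p.2 1) +
              bondDartObservable (Λ δ) δ (1 / 3) (medialCornersAt p.1 p.2 2) +
              bondDartObservable (Λ δ) δ (1 / 3) (medialCornersAt p.1 p.2 3))))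
        (𝓝[>] 0) (𝓝 0)) :
    Tendsto (fun δ : ℝ => ((δ ^ ((5:ℝ) / 3) : ℝ) : ℂ) * ∑ᶠ p : Site 2 × Fin 2,
        (fderiv ℝ φ (medialPoint δ (medialVertexOf p)) 1 -
            Complex.I * fderiv ℝ φ (medialPoint δ (medialVertexOf p)) Complex.I) / 2 *
          ((if p.2 = 0 then (1 : ℂ) else -1) * onceChiralObs (Λ δ) δ (1 / 3) (medialVertexOf p) true))
      (𝓝[>] 0) (𝓝 0) ↔
    Tendsto (fun δ : ℝ => ((δ ^ ((5:ℝ) / 3) : ℝ) : ℂ) * ∑ᶠ p : Site 2 × Fin 2,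
        (fderiv ℝ φ (medialPoint δ (medialVertexOf p)) 1 -
            Complex.I * fderiv ℝ φ (medialPoint δ (medialVertexOf p)) Complex.I) / 2 *
          (if p.2 = 0 then
              bondDartObservable (Λ δ) δ (1 / 3) (medialCornersAt p.1 p.2 1) +
                bondDartObservable (Λ δ) δ (1 / 3) (medialCornersAt p.1 p.2 3)
            else
              -(bondDartObservable (Λ δ) δ (1 / 3) (medialCornersAt p.1 p.2 0) +
                bondDartObservable (Λ δ) δ (1 / 3) (medialCornersAt p.1 p.2 2))))
      (𝓝[>] 0) (𝓝 0) :=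
  ⟨stub_staggeredArrivalOfOnceLeft D Λ hΛ φ hφ hc hs hfree, staggeredOnceLeft_of_staggeredArrival D Λ hΛ φ hφ hc hs hfree⟩

end Summit.CriticalPhenomena.CardyFormulaZ2.Theorems.WeakHolomorphy.SplitBypass

end
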